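import Mathlib
import Summits.NavierStokesRegularity.NavierStokesRegularity.Theorems.EulerZoomLiouvillePowerGaugeEulerLiouvilleGalileanWanderingEuler
import Summits.NavierStokesRegularity.NavierStokesRegularity.Theorems.EulerZoomLiouvillePowerGaugeEulerLiouvilleGalileanWanderingGrowth
import Summits.NavierStokesRegularity.NavierStokesRegularity.Theorems.EulerZoomLiouvillePowerGaugeEulerLiouvilleEnergySaturationShellLoc
import Summits.NavierStokesRegularity.NavierStokesRegularity.Theorems.EulerZoomLiouvillePowerGaugeEulerLiouvilleAllRhoStrata
import Summits.NavierStokesRegularity.NavierStokesRegularity.Theorems.EulerZoomLiouvillePowerGaugeEulerLiouvillePastFrameSteadyConfined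
import Summits.NavierStokesRegularity.NavierStokesRegularity.Theorems.EulerZoomLiouvillePowerGaugeEulerLiouvilleSelfSimilarPastProfileGradient
import Literature.Analysis.FluidPDE.SelfSimilarCollapseAnsatz
import HarnessLib

/-!
# Crux E `PowerGaugeEulerLiouville` (stmt-NavierStokesRegularity-19832), line `galilean-frames` (ns-idea-11 g6/g7): STUB F3
# `stub_wanderingReduce` — WANDERING SELF-SIMILAR MEMBERS ARE TRIVIAL OR ANCHORED (width seat ns-ezl-w3 g5)

Route №10 `EulerZoomLiouville` (NavierStokesRegularity), crux E.  A WANDERING self-similar member of Seregin's power-gauged ancient Euler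
class — `u(τ, y) = (T−τ)^{γ−1} V((T−τ)^{−γ}(y − ξ(τ))) + η(τ)` for `τ < T₁` (`T₁ ≤ 0`, `T₁ ≤ T`, `γ = 1/(2+ρ)`, `ξ ∈ C¹`; the centre WANDERS
along `ξ`, a uniform background `η` drifts) — is either trivial or an ANCHORED self-similar member about some fixed centre `(T, x₁)`:

* **`wandering_ae_eq_zero_or_selfSimilar`** — crux hypotheses verbatim (`0 < ρ ≤ 1/2`) + the wandering representation ⇒
  `u = 0` a.e. on the slab, OR `u τ = fun x => selfSimilarCollapse γ T W τ (x − x₁)` for all `τ < T₁` (some `x₁`, `W`);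
* **`wanderingReduce`** = `Sig.stub_wanderingReduce` of `Cruxes/PowerGaugeEulerLiouville/Lines/galilean_frames.lean` (body verbatim with the
  line's `InClass` / `IsPastWanderingMember` / `VanishesAE` / `IsPastSelfSimilarMember` unfolded): wiring
  `theorem stub_wanderingReduce : Sig.stub_wanderingReduce := …GalileanFrames.wanderingReduce`.

PROOF — levers (L1) + (L2) of the line only; the pressure lever (L3) and the D-gauge are NOT needed:
(1) (L1 in similarity variables, `wandering_background_const`) the background is slaved to the clock: `(T−τ)^{1−γ}η(τ) ≡ κ₀`, so
    `u(τ) = (T−τ)^{γ−1} Ṽ((T−τ)^{−γ}(· − ξ(τ)))` EXACTLY with `Ṽ = V + κ₀`;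
(2) (`…GalileanWanderingGrowth`, `…Slices`) a good slice gives `Ṽ ∈ L¹_loc` and the A-gauge growth `∫_{B_L}|Ṽ|² ≤ C L^{1−2ρ}`;
(3) (L2, `…GalileanWanderingEuler`) the tensor-tested weak Euler equation gives the drifted weak profile equation at EVERY `τ < T₁`, whose
    `τ`-independent left side makes `∂_e Ṽ` weakly a gradient for every increment `e = d(τ₁) − d(τ₂)` of the similarity drift
    `d(τ) = (T−τ)^{1−γ} ξ'(τ)`; the profile is weakly divergence free; so `Ṽ` is a.e.-invariant along `e` (`harmonicShearVanishes`, ns-ezl-w3 g4);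
(A) if some `e ≠ 0`: an `e`-invariant field with growth exponent `1 − 2ρ < 1` vanishes (`ae_eq_zero_of_translationInvariant_of_growth`), so
    every slice is a.e. zero and the member is energy-quiescent (`ae_eq_zero_of_gauge_of_energyVanishing_allRho`);
(B) if all `e = 0`: `ξ'(τ) = (T−τ)^{γ−1} d₀`, hence `ξ(τ) = x₁ − (T−τ)^γ m` EXACTLY (`m = d₀/γ`) and `u` is the anchored self-similar member
    with profile `Ṽ(· + m)` about `(T, x₁)` — boosted centres (`ξ = x₀ + wτ`, `w ≠ 0`) and accelerating ones fall under (A).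

WHAT THIS IS NOT: not NS regularity, not the crux E (stmt-19832 OPEN; the anchored column F4 — the needle — is untouched): a symmetry
stratum of the crux CLASS 19832 (MODEL lattice; E/NS strata), `--supports` stmt-19832. [folklore; MajdaBertozzi2002 Prop. 1.1 p. 12]
-/

noncomputable section

-- flat `Theorems/<Route><Decl>…` files of one crux share the namespace of the crux (tree convention: `Summit.<S>.<S>.…`)
set_option linter.dupNamespace false

open MeasureTheory Set Filter Topology Metric Function TopologicalSpace InnerProductSpace
open scoped ENNReal NNReal RealInnerProductSpace

namespace Summit.NavierStokesRegularity.NavierStokesRegularity.Theorems.PowerGaugeEulerLiouville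

namespace GalileanFrames

open Literature.Analysis Literature.Analysis.FunctionSpaces Literature.Analysis.FluidPDE
open Summit.NavierStokesRegularity.NavierStokesRegularity.Theorems.PowerGaugeEulerLiouville

variable {u : ℝ → EuclideanSpace ℝ (Fin 3) → EuclideanSpace ℝ (Fin 3)} {p : ℝ → EuclideanSpace ℝ (Fin 3) → ℝ}
  {H : ℝ → EuclideanSpace ℝ (Fin 3) → EuclideanSpace ℝ (Fin 3) →L[ℝ] EuclideanSpace ℝ (Fin 3)} {c : ℝ≥0}
  {V : EuclideanSpace ℝ (Fin 3) → EuclideanSpace ℝ (Fin 3)} {ξ η : ℝ → EuclideanSpace ℝ (Fin 3)} {T T₁ : ℝ}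

/-- A `C¹` path with `ξ'(τ) = (T−τ)^{γ−1} d₀` on `(−∞,T₁)` (`T₁ ≤ T`, `γ ≠ 0`) is `ξ(τ) = x₁ − (T−τ)^γ • γ⁻¹ d₀` there, with
`x₁ = ξ(τ₀) + (T−τ₀)^γ • γ⁻¹ d₀` for any `τ₀ < T₁`. [folklore] -/
theorem path_eq_of_deriv_eq_rpow_smul {γ : ℝ} (hγ : γ ≠ 0) (hξ : ContDiff ℝ 1 ξ) (hT : T₁ ≤ T) {d₀ : EuclideanSpace ℝ (Fin 3)}
    (hd : ∀ τ : ℝ, τ < T₁ → deriv ξ τ = (T - τ) ^ (γ - 1) • d₀) {τ₀ : ℝ} (hτ₀ : τ₀ < T₁) {τ : ℝ} (hτ : τ < T₁) :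
    ξ τ = (ξ τ₀ + (T - τ₀) ^ γ • γ⁻¹ • d₀) - (T - τ) ^ γ • γ⁻¹ • d₀ := by
  have hξd : Differentiable ℝ ξ := hξ.differentiable (by simp)
  set φ : ℝ → EuclideanSpace ℝ (Fin 3) := fun t => ξ t + (T - t) ^ γ • γ⁻¹ • d₀ with hφ
  have hφd : ∀ t, t < T₁ → HasDerivAt φ 0 t := by
    intro t ht
    have htT : 0 < T - t := by linarith [hT]
    have h1 : HasDerivAt (fun s : ℝ => (T - s) ^ γ) (-(γ * (T - t) ^ (γ - 1))) t := by
      have h := ((hasDerivAt_id t).const_sub T).rpow_const (p := γ) (Or.inl (by simp only [id]; exact htT.ne'))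
      simp only [id] at h
      convert h using 1; ring
    have h2 : HasDerivAt φ (deriv ξ t + (-(γ * (T - t) ^ (γ - 1))) • γ⁻¹ • d₀) t :=
      (hξd t).hasDerivAt.add (h1.smul_const _)
    rw [hd t ht, smul_smul, show -(γ * (T - t) ^ (γ - 1)) * γ⁻¹ = -((T - t) ^ (γ - 1)) by field_simp, neg_smul,
      add_neg_cancel] at h2
    exact h2
  have hconst : φ τ = φ τ₀ :=
    IsOpen.is_const_of_deriv_eq_zero isOpen_Iio isPreconnected_Iio
      (fun t ht => (hφd t ht).differentiableAt.differentiableWithinAt) (fun t ht => (hφd t ht).deriv) hτ hτ₀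
  simp only [hφ] at hconst
  rw [← hconst, add_sub_cancel_right]

/-- **WANDERING SELF-SIMILAR MEMBERS ARE TRIVIAL OR ANCHORED** (line `galilean-frames`, stub F3; `0 < ρ ≤ 1/2`, `γ = 1/(2+ρ)`).
Crux hypotheses verbatim + `u τ = fun y => (T−τ)^{γ−1} • V ((T−τ)^{−γ} • (y − ξ τ)) + η τ` for `τ < T₁` (`T₁ ≤ 0`, `T₁ ≤ T`, `ξ ∈ C¹`)
⇒ `u = 0` a.e. on the slab, OR `u τ = fun x => selfSimilarCollapse γ T W τ (x − x₁)` for all `τ < T₁` (some centre `x₁`, profile `W`).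
[folklore; MajdaBertozzi2002 Prop. 1.1 p. 12] -/
theorem wandering_ae_eq_zero_or_selfSimilar {ρ : ℝ} (hρ : 0 < ρ) (hρ2 : ρ ≤ 1 / 2)
    (hsw : IsSuitableWeakSolutionOn (slab (EuclideanSpace ℝ (Fin 3)) (Iio 0) isOpen_Iio) 0 0 u p)
    (hH : HasWeakSpatialGradientOn (slab (EuclideanSpace ℝ (Fin 3)) (Iio 0) isOpen_Iio) u H)
    (hc : ∀ a : ℝ, 0 < a → ENNReal.ofReal (a ^ (2 * ρ)) * cknA a (0 : ℝ × EuclideanSpace ℝ (Fin 3)) u +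
        ENNReal.ofReal (a ^ ρ) * cknE a (0 : ℝ × EuclideanSpace ℝ (Fin 3)) H +
        ENNReal.ofReal (a ^ (2 * ρ)) * cknD a (0 : ℝ × EuclideanSpace ℝ (Fin 3)) p ≤ (c : ℝ≥0∞))
    (hT₁ : T₁ ≤ 0) (hT : T₁ ≤ T) (hξ : ContDiff ℝ 1 ξ)
    (hu : ∀ τ : ℝ, τ < T₁ → u τ = fun y =>
      (T - τ) ^ (1 / (2 + ρ) - 1) • V ((T - τ) ^ (-(1 / (2 + ρ))) • (y - ξ τ)) + η τ) :
    uncurry u =ᵐ[volume.restrict (Iio (0 : ℝ) ×ˢ (univ : Set (EuclideanSpace ℝ (Fin 3))))] 0 ∨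
      ∃ (x₁ : EuclideanSpace ℝ (Fin 3)) (W : EuclideanSpace ℝ (Fin 3) → EuclideanSpace ℝ (Fin 3)),
        ∀ τ : ℝ, τ < T₁ → u τ = fun x => selfSimilarCollapse (1 / (2 + ρ)) T W τ (x - x₁) := by
  set γ : ℝ := 1 / (2 + ρ) with hγdef
  have hγ : 0 < γ := by rw [hγdef]; positivity
  have hγ1 : γ ≤ 1 := by
    rw [hγdef, div_le_one (by linarith)]; linarith
  have hA : ∀ a : ℝ, 0 < a → ENNReal.ofReal (a ^ (2 * ρ)) * cknA a (0 : ℝ × EuclideanSpace ℝ (Fin 3)) u ≤ (c : ℝ≥0∞) :=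
    fun a ha => le_trans (le_trans le_self_add le_self_add) (hc a ha)
  have hsol : IsDistributionalNSSolutionOn (slab (EuclideanSpace ℝ (Fin 3)) (Iio 0) isOpen_Iio) 0 0 u p := hsw.distributional
  -- ### a good slice: the profile is measurable and locally integrable
  have hne : (ae (volume.restrict (Iio T₁))).NeBot := by
    rw [ae_neBot, Ne, Measure.restrict_eq_zero, Real.volume_Iio]; exact ENNReal.top_ne_zero
  obtain ⟨τ', hτ'W, hτ'T⟩ := ((FrameSteady.ae_hasWeakFDerivOn_slice_past hH hT₁).and (ae_restrict_mem measurableSet_Iio)).exists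
  have hτ'T : τ' < T₁ := hτ'T
  have hl' : 0 < T - τ' := by linarith
  have hs' : 0 < (T - τ') ^ γ := Real.rpow_pos_of_pos hl' _
  have hul : LocallyIntegrable (u τ') volume :=
    locallyIntegrableOn_univ.1 (by simpa only [Opens.coe_top] using hτ'W.locallyIntegrableOn)
  have hVeq : V = fun Y => (T - τ') ^ (1 - γ) • (u τ' (ξ τ' + (T - τ') ^ γ • Y) - η τ') := by
    funext Y
    rw [hu τ' hτ'T]
    simp only [add_sub_cancel_left, smul_smul, Real.rpow_neg hl'.le, inv_mul_cancel₀ hs'.ne', one_smul, add_sub_cancel_right]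
    rw [← Real.rpow_add hl', show (1 - γ + (γ - 1) : ℝ) = 0 by ring, Real.rpow_zero, one_smul]
  have hVm : AEStronglyMeasurable V volume := by
    rw [hVeq]
    exact ((hul.aestronglyMeasurable.comp_quasiMeasurePreserving (Past.quasiMeasurePreserving_add_smul hs'.ne' (ξ τ'))).sub
      aestronglyMeasurable_const).const_smul ((T - τ') ^ (1 - γ))
  have hVl : LocallyIntegrable V volume := by
    rw [hVeq]
    have h1 := locallyIntegrable_comp_add_right_general hul (ξ τ')
    have h2 := locallyIntegrable_comp_smul h1 hs'.ne'
    have h3 : LocallyIntegrable (fun Y => u τ' (ξ τ' + (T - τ') ^ γ • Y)) volume :=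
      h2.congr (Eventually.of_forall fun Y => by simp only [add_comm])
    have h4 : LocallyIntegrable (fun Y => u τ' (ξ τ' + (T - τ') ^ γ • Y) - η τ') volume :=
      h3.sub (locallyIntegrable_const _)
    simpa only [Pi.smul_def] using h4.smul ((T - τ') ^ (1 - γ))
  -- ### (1) the background is slaved to the clock; absorb it
  set t₀ : ℝ := T₁ - 1 with ht₀
  have ht₀T : t₀ < T₁ := by rw [ht₀]; linarith
  set κ₀ : EuclideanSpace ℝ (Fin 3) := (T - t₀) ^ (1 - γ) • η t₀ with hκ₀
  have hκ : ∀ τ : ℝ, τ < T₁ → (T - τ) ^ (1 - γ) • η τ = κ₀ := fun τ hτ =>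
    wandering_background_const hρ hρ2 hA hT₁ hT hVm hu hτ ht₀T
  set Vt : EuclideanSpace ℝ (Fin 3) → EuclideanSpace ℝ (Fin 3) := fun Y => V Y + κ₀ with hVt
  have hu' : ∀ τ : ℝ, τ < T₁ → u τ = fun y => (T - τ) ^ (γ - 1) • Vt ((T - τ) ^ (-γ) • (y - ξ τ)) := by
    intro τ hτ
    have hl : 0 < T - τ := by linarith
    rw [hu τ hτ]
    funext y
    simp only [hVt, smul_add]
    congr 1
    rw [← hκ τ hτ, smul_smul, ← Real.rpow_add hl, show (γ - 1 + (1 - γ) : ℝ) = 0 by ring, Real.rpow_zero, one_smul]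
  have hVtm : AEStronglyMeasurable Vt volume := hVm.add aestronglyMeasurable_const
  have hVtl : LocallyIntegrable Vt volume := hVl.add (locallyIntegrable_const _)
  -- ### (2) growth of `Vt` and `|Vt|² ∈ L¹_loc`
  obtain ⟨Cg, hCgtop, hgrow⟩ := wandering_profile_growth hρ hρ2 hA hT₁ hT ht₀T (hu t₀ ht₀T)
  have hgrowVt : ∀ L : ℝ, 1 ≤ L → ∫⁻ Y in ball (0 : EuclideanSpace ℝ (Fin 3)) L, ‖Vt Y‖ₑ ^ 2 ≤ Cg * ENNReal.ofReal (L ^ (1 - 2 * ρ)) :=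
    fun L hL => hgrow L hL
  have hVt2 : LocallyIntegrable (fun Y => ‖Vt Y‖ ^ 2) volume := by
    refine EnergySaturation.locallyIntegrable_norm_sq_of_growth_loc (ρ := ρ) hVtm (c := Cg.toNNReal) fun L hL => ?_
    rw [ENNReal.coe_toNNReal hCgtop]
    exact hgrowVt L hL
  have hgrowC : ∀ R : ℝ, 1 ≤ R → ∫⁻ z in ball (0 : EuclideanSpace ℝ (Fin 3)) R, ‖Vt z + 0‖ₑ ^ 2 ≤
      ENNReal.ofReal (Cg.toReal * R ^ (1 - 2 * ρ)) := by
    intro R hR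
    simp only [add_zero]
    rw [ENNReal.ofReal_mul ENNReal.toReal_nonneg, ENNReal.ofReal_toReal hCgtop]
    exact hgrowVt R hR
  -- ### (3) weak divergence freeness and the drift condition; invariance along drift increments
  have hdivU : ∀ φ : EuclideanSpace ℝ (Fin 3) → ℝ, ContDiff ℝ (⊤ : ℕ∞) φ → HasCompactSupport φ →
      ∫ z, ⟪Vt z, gradient φ z⟫ = 0 :=
    fun φ hφ hφc => wandering_profile_integral_inner_gradient_eq_zero hsol hT₁ hT hγ hγ1 hξ hVtl hu' hφ hφc
  set d : ℝ → EuclideanSpace ℝ (Fin 3) := fun τ => (T - τ) ^ (1 - γ) • deriv ξ τ with hd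
  have hinv : ∀ τ₁ τ₂ : ℝ, τ₁ < T₁ → τ₂ < T₁ → ∀ s : ℝ, (fun z => Vt (z + s • (d τ₁ - d τ₂))) =ᵐ[volume] Vt := by
    intro τ₁ τ₂ hτ₁ hτ₂ s
    refine harmonicShearVanishes ρ hρ Vt 0 (d τ₁ - d τ₂) Cg.toReal hVtl hgrowC hdivU ?_ s
    intro Φ hΦ hΦc htr
    exact wandering_drift_weaklyGradient hsol hT₁ hT hγ hγ1 hξ hVtm hVtl hVt2 hu' ⟨hΦ, hΦc, by simp⟩ htr hτ₁ hτ₂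
  -- ### case split on the similarity drift
  by_cases hD : ∃ τ₁ τ₂ : ℝ, τ₁ < T₁ ∧ τ₂ < T₁ ∧ d τ₁ ≠ d τ₂
  · -- (A) a non-zero invariance direction: the profile vanishes, the member is quiescent
    left
    obtain ⟨τ₁, τ₂, hτ₁, hτ₂, hne12⟩ := hD
    have he : d τ₁ - d τ₂ ≠ 0 := sub_ne_zero.2 hne12
    have hVt0 : Vt =ᵐ[volume] 0 :=
      ae_eq_zero_of_translationInvariant_of_growth hVtm he (hinv τ₁ τ₂ hτ₁ hτ₂) hCgtop (by linarith) (by linarith) hgrowVt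
    have hslice0 : ∀ τ : ℝ, τ < T₁ → u τ =ᵐ[volume] 0 := by
      intro τ hτ
      have hl : 0 < T - τ := by linarith
      have hdτ : (T - τ) ^ (-γ) ≠ 0 := (Real.rpow_pos_of_pos hl _).ne'
      have h1 := (Past.quasiMeasurePreserving_smul_sub hdτ (ξ τ)).ae_eq_comp hVt0
      rw [hu' τ hτ]
      filter_upwards [h1] with y hy
      simp only [comp_apply, Pi.zero_apply] at hy
      simp [hy]
    refine ae_eq_zero_of_gauge_of_energyVanishing_allRho hρ.le hsw hH hc fun ε hε N => ?_
    have hsub : Iio (min (-N) T₁) ⊆ {s : ℝ | s < -N ∧ ∫⁻ x, ‖u s x‖ₑ ^ 2 ≤ ENNReal.ofReal ε} := by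
      intro s hs
      rw [mem_Iio, lt_min_iff] at hs
      refine ⟨hs.1, ?_⟩
      have hae : (fun x => ‖u s x‖ₑ ^ 2) =ᵐ[volume] fun _ => 0 := by
        filter_upwards [hslice0 s hs.2] with x hx
        simp [hx]
      rw [lintegral_congr_ae hae, lintegral_zero]
      exact zero_le
    intro h0
    have h := measure_mono_null hsub h0
    rw [Real.volume_Iio] at h
    exact ENNReal.top_ne_zero h
  · -- (B) constant similarity drift: the centre is a re-centring, the member is anchored
    right
    have hD' : ∀ τ₁ τ₂ : ℝ, τ₁ < T₁ → τ₂ < T₁ → d τ₁ = d τ₂ := fun τ₁ τ₂ h1 h2 => by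
      by_contra hne; exact hD ⟨τ₁, τ₂, h1, h2, hne⟩
    set d₀ : EuclideanSpace ℝ (Fin 3) := d t₀ with hd₀
    have hderiv : ∀ τ : ℝ, τ < T₁ → deriv ξ τ = (T - τ) ^ (γ - 1) • d₀ := by
      intro τ hτ
      have hl : 0 < T - τ := by linarith
      have h := hD' τ t₀ hτ ht₀T
      simp only [hd] at h
      rw [hd₀, hd]
      simp only
      rw [← h, smul_smul, ← Real.rpow_add hl, show (γ - 1 + (1 - γ) : ℝ) = 0 by ring, Real.rpow_zero, one_smul]
    set m : EuclideanSpace ℝ (Fin 3) := γ⁻¹ • d₀ with hm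
    set x₁ : EuclideanSpace ℝ (Fin 3) := ξ t₀ + (T - t₀) ^ γ • m with hx₁
    have hpath : ∀ τ : ℝ, τ < T₁ → ξ τ = x₁ - (T - τ) ^ γ • m := fun τ hτ =>
      path_eq_of_deriv_eq_rpow_smul hγ.ne' hξ hT hderiv ht₀T hτ
    refine ⟨x₁, fun Z => Vt (Z + m), fun τ hτ => ?_⟩
    have hl : 0 < T - τ := by linarith
    rw [hu' τ hτ]
    funext y
    rw [selfSimilarCollapse_apply, hpath τ hτ]
    congr 2
    rw [show y - (x₁ - (T - τ) ^ γ • m) = (y - x₁) + (T - τ) ^ γ • m by abel, smul_add, smul_smul, Real.rpow_neg hl.le,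
      inv_mul_cancel₀ (Real.rpow_pos_of_pos hl _).ne', one_smul]

/-- **F3 OF LINE `galilean-frames`** (`Sig.stub_wanderingReduce` of `Cruxes/PowerGaugeEulerLiouville/Lines/galilean_frames.lean`, body verbatim
with the line's reducible `InClass` / `VanishesAE` and its `IsPastWanderingMember` / `IsPastSelfSimilarMember` unfolded): a WANDERING
self-similar member of the class is either trivial or an ANCHORED self-similar member. [folklore; MajdaBertozzi2002 Prop. 1.1 p. 12] -/
theorem wanderingReduce :
    ∀ ρ : ℝ, 0 < ρ → ρ ≤ 1 / 2 →
      ∀ (u : ℝ → EuclideanSpace ℝ (Fin 3) → EuclideanSpace ℝ (Fin 3)) (p : ℝ → EuclideanSpace ℝ (Fin 3) → ℝ)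
        (H : ℝ → EuclideanSpace ℝ (Fin 3) → EuclideanSpace ℝ (Fin 3) →L[ℝ] EuclideanSpace ℝ (Fin 3)) (c : ℝ≥0),
      (IsSuitableWeakSolutionOn (slab (EuclideanSpace ℝ (Fin 3)) (Set.Iio 0) isOpen_Iio) 0 0 u p ∧
        HasWeakSpatialGradientOn (slab (EuclideanSpace ℝ (Fin 3)) (Set.Iio 0) isOpen_Iio) u H ∧
        (∀ a : ℝ, 0 < a →
          ENNReal.ofReal (a ^ (2 * ρ)) * cknA a (0 : ℝ × EuclideanSpace ℝ (Fin 3)) u +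
              ENNReal.ofReal (a ^ ρ) * cknE a (0 : ℝ × EuclideanSpace ℝ (Fin 3)) H +
            ENNReal.ofReal (a ^ (2 * ρ)) * cknD a (0 : ℝ × EuclideanSpace ℝ (Fin 3)) p ≤ (c : ℝ≥0∞))) →
      (∃ (T T₁ : ℝ) (ξ η : ℝ → EuclideanSpace ℝ (Fin 3)) (V : EuclideanSpace ℝ (Fin 3) → EuclideanSpace ℝ (Fin 3)),
        T₁ ≤ 0 ∧ T₁ ≤ T ∧ ContDiff ℝ 2 ξ ∧
          ∀ τ : ℝ, τ < T₁ → u τ = fun y =>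
            (T - τ) ^ (1 / (2 + ρ) - 1) • V ((T - τ) ^ (-(1 / (2 + ρ))) • (y - ξ τ)) + η τ) →
      Function.uncurry u =ᵐ[volume.restrict (Set.Iio (0 : ℝ) ×ˢ (Set.univ : Set (EuclideanSpace ℝ (Fin 3))))] 0 ∨
        ∃ (T T₁ : ℝ) (x₀ : EuclideanSpace ℝ (Fin 3)) (V : EuclideanSpace ℝ (Fin 3) → EuclideanSpace ℝ (Fin 3)),
          T₁ ≤ 0 ∧ T₁ ≤ T ∧ ∀ τ : ℝ, τ < T₁ → u τ = fun x => selfSimilarCollapse (1 / (2 + ρ)) T V τ (x - x₀) := by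
  intro ρ hρ hρ2 u p H c h hW
  obtain ⟨T, T₁, ξ, η, V, hT₁, hT, hξ, hu⟩ := hW
  rcases wandering_ae_eq_zero_or_selfSimilar hρ hρ2 h.1 h.2.1 h.2.2 hT₁ hT (hξ.of_le one_le_two) hu with h0 | ⟨x₁, W, hW⟩
  · exact Or.inl h0
  · exact Or.inr ⟨T, T₁, x₁, W, hT₁, hT, hW⟩

end GalileanFrames

end Summit.NavierStokesRegularity.NavierStokesRegularity.Theorems.PowerGaugeEulerLiouville
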